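import Literature.MathematicalPhysics.QuantumFieldTheory.Balaban1983to89.B9SupplySockB9P3ZdGammaUnivDelta

/-!
# `Balaban1983to89.B9SupplySockB9P3ZdGammaUnivDelta2` — [Balaban1985BackgroundPropagators] (3.42)∕(3.43)∕(3.47) pp. 397–398, Thm 3.3 p. 399 ∕ [Balaban1985RegularSpaces]
# Prop. 3 p. 87, (1.59) p. 86: EDITION δ₂ OF THE J-N06→N05 JUNCTION'S HÖLDER BINDER AND SOCKET — the weighted Hölder class with BOTH points of the pair in
# `Ω_j` (print never weighs a pair by the level of its first point alone), fed (3.42) AND (3.43), constant `CH(δ₀)·(B₀ + max{0, B₀(β)})`; the univ-road member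
# supplier and its family re-derived for the socket variant `SockB9P3H2`; A6 at truncation 0

statement-level skeleton of published theorems with citation tags; proofs where landed; nothing here is a claim about the
Yang–Mills mass gap

`[Balaban1985BackgroundPropagators]` ("B9", CMP **99** (1985) 389–434) p. 398, verbatim: *«|(Q₁ − Q₂)(∇_U G′(U)λ)|_β ≤ B₀(β)(Lʲη)^{1−β}‖ζ‖_β e^{−δ₀d(y,y′)}|λ| for 0 ≤ β
≤ β₀ < 1, ζ ∈ C₀^∞(Δ̃(y)), y ∈ Λ_j, supp λ ⊂ Δ(y′)» (3.43)*, *«The norm | · |_β is the Hölder norm … on the ξ-lattice»*, (3.42) *«|G′(U)λ|, |∇_UG′(U)λ|, … ≤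
B₀(…)e^{−δ₀d(y,y′)}|λ| on Δ(y)»*, (3.47) (the GLOBAL weighted inequalities are the SUP ones — no global Hölder line is printed); `[Balaban1985RegularSpaces]`
("B8") Prop. 3 p. 87 *«B₀(β₀) … the corresponding norms of the operators G(U₀), H(U₀)»*, (1.39) p. 82 (the Hölder condition of the class on `Ω_j`), (1.59) p. 86.

CITATION HEADER (lean-in-tree rule).  Cell `pub-ymgap`, DAG node N06 = [B9], seat `pub-ymgap-dag-n06-b` gen 17 (BINDER OWNER of the junction; EDITION δ =
`B9SupplySockB9P3ZdGammaUnivDelta` p587685).  WHY THIS EDITION (dag-n06-w2 g2's located reading (L-H1) + INTENT-3 `B9Eq343HolderBothZdFinite`, cell bus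
2026-08-28T02:04Z ∕ 02:16Z, lit-balaban-r06 PRINT WORD l.26723): the Hölder binder `HolderAtδ` (as `HolderAt` before it) and the socket `B8LeafModelZd3.SockB9P3`'s
line 5 weigh a pair `(x, x′)` by `(Lʲη)^{2+β}` whenever the FIRST point `x ∈ Ω_j` — a far pair with `x′` adjacent OUTSIDE `Ω_j` is then not k-uniformly bounded
from (3.42)+(3.43) (the n = 1 sup entry at `x′` lives at a coarser scale); print's blocks supply the class with BOTH points in `Ω_j`, and the supply of a far
pair needs (3.42)'s `|∇_UG′λ|` entry besides (3.43) — hence (δ′) the class `q.2.2 ∈ AdmPair ∧ q.2.2.1 ∈ Ω_j ∧ q.2.2.2 ∈ Ω_j`, (δ″) the binder is fed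
`Ineq342_346_347` AND `Ineq343_345`, and the constant reads `B₀` too: `CH δ₀ · (B₀ + max 0 (Bβ β))` (dag-n06-w2's discharge on finite members:
`B9Eq343HolderBothZdFinite.holderBoth_msup_le_CH`, `CH δ₀ := max (R·S) (2·4^β·R₁·S)`).  The SOCKET must shrink its line 5 to the same class: `SockB9P3H2` =
`SockB9P3` VERBATIM except line 5's class (defined here, as edition D4's `SockB9P3D4` was; the N05 owners re-key their `SB9all`-type binders to it when they
want the genuine Hölder letter — socket-consumer question (a)(b) asked on the bus, dag-n05-d).  REUSED BY NAME: everything of edition δ's imports; the proofs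
are edition δ's (`sockB9P3PIδ_at_univ`, `sockB9P3PIδ_allLevels_univ_explicit_on`, `binders_inhabited_univ_zero_linPIδ`) VERBATIM up to the displayed tokens.

WHAT IS DECLARED ∕ PROVED (kernel, 0 sorry; two definitions WITH BODY + theorems; no `instance`, no `notation`).
* §1 ★ `HolderAtδ2 geo bg GA L mem ιCfg ops β len CH M i m` (def: `∀ Bβ Bε Bεβ δ₀ B₀ U₀ hU₀, 0 < δ₀ → Ineq342_346_347 (GA …) B₀ δ₀ (ιCfg …) → Ineq343_345 (GA …) Bβ Bε Bεβ δ₀ (ιCfg …) →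
  ∀ J, msup L m η (−(2+β)) (fun j q => q.2.2 ∈ AdmPair η len ∧ q.2.2.1 ∈ Ω j ∧ q.2.2.2 ∈ Ω j) (hquot … ∇G(U₀)J …) ≤ CH δ₀ · (B₀ + max 0 (Bβ β)) · |J|₍₋₃₎`) ·
  ★ `SockB9P3H2` (def: `B8LeafModelZd3.SockB9P3`'s text with line 5 over the both-points class) · `sockB9P3H2_anti`.
* §2 ★★ `sockB9P3PIδ2_at_univ` — the univ-road member supplier for `SockB9P3H2` (edition δ's proof; line 5 from `HolderAtδ2` fed both blocks; B₀β′ := `2·max 0 (CH δ₀·(B₀ +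
  max 0 (Bβ β)))·max{1,q}`, other constants unchanged) · ★ `sockB9P3PIδ2_allLevels_univ_explicit_on` (the family form at explicit constants).
* §3 `B0_nonneg_of_ineq342` (the (3.42)∕(3.47) block of the witness frame pins `B₀ ≥ 0`), `holder_line2` (the witness's Hölder line over the smaller class), ★★
  `binders_inhabited_univ_zero_linPIδ2` — A6: the TEN-letter hypothesis set with `HolderAtδ2` in place of `HolderAtδ` (and both Thm-3.3 blocks) is inhabited at every
  member with `Ω 0 = ℤᵈ`, truncation `m = 0`, every class whose level-0 set at truncation 0 is all bonds (edition δ's witness `opsU ∕ geoU ∕ bgW ∕ GAU` BY IMPORT).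
HONEST SCOPE.  (i) A binder∕socket RE-TYPING in the junction's own currency (no estimate); the ANALYTIC supply of `HolderAtδ2` is dag-n06-w2's chain — today on FINITE
members only (`B9Eq343HolderBothZdFinite`, `[Fintype]`), with the Lemma-2.1 letters member-uniform only modulo the ξ-scaled cut-off norm (L-H2); on the univ road
(`Ω 0 = ℤᵈ`, this file's suppliers) `HolderAtδ2` stays a HYPOTHESIS.  (ii) The SOURCED road (`SrcHolderAt`, the `SB9srcH ∕ SH59src` bodies' Hölder lines) is NOT
re-typed here — it waits for the N05 owners' word on their socket texts.  (iii) `SockB9P3H2` has no consumer yet (N05's knits read `SockB9P3`); whether [B8] (1.39)'s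
use of the Hölder line accepts the both-points class is the N05∕lit-balaban reading asked on the bus.  (iv) Count-neutral helper of K1⁷; N05∕N06 NOT discharged;
one finite `𝕋⁴` programme at fixed `ε`, Bałaban AS PRINTED; nothing continuum ∕ `ℝ⁴` ∕ OS ∕ mass-gap ∕ Clay.  Unit `pub-ymgap-dag-n06-b` (g17), 2026-08-28.
-/

noncomputable section

open NormedSpace

namespace Literature.MathematicalPhysics.QuantumFieldTheory.Balaban1983to89.B9SupplySockB9P3ZdGammaUnivDelta2

open Complex (I)
open MatrixLog B7Prop1Explicit B7Prop2Explicit B7Prop1Local B7Eq92Concrete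
open B7Prop4GeneralLevels (linCovIter)
open B7Eq78Linearization (conjR)
open B8Ineq132 (covDerivFwd covDeriv InAk BondTouches)
open B8Eq119TwistedAxial (Restr129 InAx)
open B8Eq184Proof (cfgExp)
open B8Lemma1NonAbelian (mulCfg)
open B8Eq140Level (SideTouches)
open B8Eq146AExpansion (iEta plaqCovDeriv)
open B8Eq143PlaqExpansion (pdiv)
open B8Eq155JBound (Jcur wsup)
open B8ScaledSupNorm (bondNorm msup weight Bdd)
open B8Eq138LandauZd (IsLandau138 IsLandau138W IsLandau146 IsLandau146W InR138 QT covDivB logCfg covLap)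
open B8LanF146 (LanF146)
open B8LeafModelZd (ZdIdx)
open B8LeafModelZd3 (SockB9P3)
open B9Eq340HolderZd (hquot AdmPair trans)
open B9SupplySockB9P3ZdLetters (OpsZd deltaAOf DictGlob Prop6Feed HolderGlob)
open B9SupplySockB9P3ZdLettersOmega (OnDom restrictDom outerPart Margin2 InvOnDom CurvSmallDom LandauKillsDom AvgBoundDom SockB9P3D4)
open B9SupplySockB9P3ZdOmega (collar_arith)
open B9SupplySockB9P3ZdSrc (GopAdd SourceTermDom SourceHolderDom msup_eq_zero_of_not_bdd msup_le_add_of_norm_le hquot_add_le hquot_sub_le trans_add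
  apriori_arith_src)
open B9SupplySockB9P3ZdAt (DictAt Prop6At InvAt CurvAt LandauAt AvgAt HolderAt GopAddAt SrcAt SrcHolderAt)
open B9SupplySockB9P3ZdAtLin (LinBddAt)
open B9SupplySockB9P3ZdUnivWitness (BddF)
open B9SupplySockB9P3ZdGammaUniv (AvgAtP)
open B9SupplySockB9P3ZdGammaInAk (CurvAtInAk)
open B8Prop3GaugeFixedKLevel (mem_unitaryUnits_of_mgauge_eq mulCfg_eq_gaugeAct_of_mgauge_eq)
open B9SupplySockB9P3ZdGammaUnivDelta (HolderAtδ)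

-- `Site` alone could resolve to the torus sites of `Setup.lean`; re-export the `ℤ^d` sites of `B7Prop1Explicit`.
export B7Prop1Explicit (Site)

variable {d : ℕ} {𝔸 : Type*} [CStarAlgebra 𝔸]

/-! ## §1 The Hölder binder with both points in `Ω_j`, fed (3.42) and (3.43), and the socket variant `SockB9P3H2` -/

section Binders

variable {I : Type} (geo : I → B9.Geometry) (bg : I → B9.Backgrounds) (GA : ∀ i, B9.KernelFamily (geo i) (bg i))
variable (L : ℕ) (mem : ℝ → ZdIdx d L → ℕ → I)
variable (ιCfg : ∀ (M : ℝ) (i : ZdIdx d L) (m : ℕ) (U₀ : Site d → Fin d → 𝔸ˣ),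
  (∀ x κ, U₀ x κ ∈ unitaryUnits 𝔸) → (bg (mem M i m)).Cfg)

/-- ★ **THE GLOBAL WEIGHTED HÖLDER READING OF ∇_{U₀}G(U₀) OVER PAIRS WITH BOTH POINTS IN `Ω_j`, FED BOTH BLOCKS OF THEOREM 3.3** — edition δ₂ of
`B9SupplySockB9P3ZdGammaUnivDelta.HolderAtδ`: the class is `q.2.2 ∈ AdmPair ∧ q.2.2.1 ∈ Ω_j ∧ q.2.2.2 ∈ Ω_j` (print never weighs a pair by the level of its
first point alone), the inputs are `0 < δ₀`, the (3.42)∕(3.46)∕(3.47) block `Ineq342_346_347 … B₀ δ₀` AND the Hölder block `Ineq343_345 … Bβ Bε Bεβ δ₀` (far pairs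
need the n = 1 sup entry), and the constant reads `CH δ₀ · (B₀ + max 0 (Bβ β))`. [cite: Balaban1985BackgroundPropagators, (3.42)–(3.43), (3.47) pp.397–398, Thm 3.3 p.399; Balaban1985RegularSpaces, Prop. 3 p.87, (1.39) p.82, (1.59) p.86] -/
def HolderAtδ2 (ops : ℝ → ZdIdx d L → ℕ → OpsZd d 𝔸) (β : ℝ) (len : Site d → ℝ) (CH : ℝ → ℝ) (M : ℝ) (i : ZdIdx d L) (m : ℕ) : Prop :=
  ∀ (Bβ Bε : ℝ → ℝ) (Bεβ : ℝ → ℝ → ℝ) (δ₀ B₀ : ℝ) (U₀ : Site d → Fin d → 𝔸ˣ) (hU₀ : ∀ x κ, U₀ x κ ∈ unitaryUnits 𝔸), 0 < δ₀ →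
    B9.Ineq342_346_347 (GA (mem M i m)) B₀ δ₀ (ιCfg M i m U₀ hU₀) →
    B9.Ineq343_345 (GA (mem M i m)) Bβ Bε Bεβ δ₀ (ιCfg M i m U₀ hU₀) →
    ∀ J : Site d → Fin d → 𝔸,
      msup L m i.η (-(2 + β))
          (fun j (q : Fin d × Fin d × (Site d × Site d)) => q.2.2 ∈ AdmPair i.η len ∧ q.2.2.1 ∈ i.Ω j ∧ q.2.2.2 ∈ i.Ω j)
          (fun q => hquot i.η β len U₀ (covDerivFwd i.η U₀ q.1 (fun z => (ops M i m).Gop U₀ J z q.2.1)) q.2.2)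
        ≤ CH δ₀ * (B₀ + max 0 (Bβ β)) * bondNorm L m i.η (-(3 : ℝ)) i.Ω J

end Binders

section Socket

variable [Nontrivial 𝔸]

/-- ★ **THE (1.59) SOCKET WITH THE BOTH-POINTS HÖLDER LINE** — `B8LeafModelZd3.SockB9P3 L B₀ B₀β cP β len η k Ω Λs Λb` VERBATIM except that line 5's weighted Hölder
supremum runs over the admissible pairs with BOTH points in `Ω_j` (`q.2.2 ∈ AdmPair η len ∧ q.2.2.1 ∈ Ω j ∧ q.2.2.2 ∈ Ω j`), the class [4] (3.42)+(3.43) supply.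
[cite: Balaban1985RegularSpaces, (1.59) p.86, (1.39) p.82, Prop. 3 p.87; Balaban1985BackgroundPropagators, (3.43), (3.47) p.398] -/
def SockB9P3H2 (L : ℕ) (B₀ B₀β cP β : ℝ) (len : Site d → ℝ) (η : ℝ) (k : ℕ) (Ω : ℕ → Set (Site d))
    (Λs : ℕ → ℕ → Set (Site d)) (Λb : ℕ → ℕ → Set (Site d × Fin d)) : Prop :=
  ∀ α₀ α₂ : ℝ, 0 < α₀ → α₀ ≤ cP → 0 < α₂ → α₂ ≤ cP →
    ∀ (U₀ W : Site d → Fin d → 𝔸ˣ), (∀ x κ, U₀ x κ ∈ unitaryUnits 𝔸) → (∀ x κ, W x κ ∈ unitaryUnits 𝔸) →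
    InAk L k η α₀ Ω U₀ → InAk L k η α₀ Ω (mulCfg W U₀) → IsLandau138W L k η (Ω 0) (Λs k) U₀ W →
    ∀ A' : Site d → Fin d → 𝔸, (∀ y τ, IsSelfAdjoint (A' y τ)) →
    (∀ j, j ≤ k → ∀ (y : Site d) (τ : Fin d), SideTouches (Ω j) y τ →
      W y τ = cfgExp η A' y τ ∧ ‖A' y τ‖ ≤ α₂ * ((L : ℝ) ^ j * η)⁻¹) →
    (∀ (y : Site d) (τ : Fin d), (∀ j, j ≤ k → ¬ SideTouches (Ω j) y τ) → A' y τ = 0) →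
    msup L k η (-(1 : ℝ)) (fun j (b : Site d × Fin d) => SideTouches (Ω j) b.1 b.2) (fun b => A' b.1 b.2)
        ≤ B₀ * (bondNorm L k η (-(3 : ℝ)) Ω (fun x μ => Jcur η U₀ A' μ x)
          + wsup 1 (fun p : {p : ℕ × (Site d × Fin d) // p.1 ≤ k ∧ p.2 ∈ Λb k p.1} =>
              linCovIter L U₀ (iEta η A') p.1.1 p.1.2.1 p.1.2.2)) ∧
      msup L k η (-(2 : ℝ)) (fun j (t : Fin d × Fin d × Site d) => SideTouches (Ω j) t.2.2 t.2.1)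
          (fun t => covDerivFwd η U₀ t.1 (fun z => A' z t.2.1) t.2.2)
        ≤ B₀ * (bondNorm L k η (-(3 : ℝ)) Ω (fun x μ => Jcur η U₀ A' μ x)
          + wsup 1 (fun p : {p : ℕ × (Site d × Fin d) // p.1 ≤ k ∧ p.2 ∈ Λb k p.1} =>
              linCovIter L U₀ (iEta η A') p.1.1 p.1.2.1 p.1.2.2)) ∧
      bondNorm L k η (-(3 : ℝ)) Ω (fun x μ => pdiv η U₀ (plaqCovDeriv η U₀ A') μ x)
        ≤ B₀ * (bondNorm L k η (-(3 : ℝ)) Ω (fun x μ => Jcur η U₀ A' μ x)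
          + wsup 1 (fun p : {p : ℕ × (Site d × Fin d) // p.1 ≤ k ∧ p.2 ∈ Λb k p.1} =>
              linCovIter L U₀ (iEta η A') p.1.1 p.1.2.1 p.1.2.2)) ∧
      bondNorm L k η (-(3 : ℝ)) Ω (fun x μ => covLap η U₀ (fun z => A' z μ) x)
        ≤ B₀ * (bondNorm L k η (-(3 : ℝ)) Ω (fun x μ => Jcur η U₀ A' μ x)
          + wsup 1 (fun p : {p : ℕ × (Site d × Fin d) // p.1 ≤ k ∧ p.2 ∈ Λb k p.1} =>
              linCovIter L U₀ (iEta η A') p.1.1 p.1.2.1 p.1.2.2)) ∧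
      msup L k η (-(2 + β)) (fun j (q : Fin d × Fin d × (Site d × Site d)) => q.2.2 ∈ AdmPair η len ∧ q.2.2.1 ∈ Ω j ∧ q.2.2.2 ∈ Ω j)
          (fun q => hquot η β len U₀ (covDerivFwd η U₀ q.1 (fun z => A' z q.2.1)) q.2.2)
        ≤ B₀β * (bondNorm L k η (-(3 : ℝ)) Ω (fun x μ => Jcur η U₀ A' μ x)
          + wsup 1 (fun p : {p : ℕ × (Site d × Fin d) // p.1 ≤ k ∧ p.2 ∈ Λb k p.1} =>
              linCovIter L U₀ (iEta η A') p.1.1 p.1.2.1 p.1.2.2))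

omit [Nontrivial 𝔸] in
/-- `SockB9P3H2` is antitone in the threshold `cP`. [cite: Balaban1985RegularSpaces, (1.59) p.86] -/
theorem sockB9P3H2_anti {L : ℕ} {B₀ B₀β cP cP' β : ℝ} {len : Site d → ℝ} (h : cP' ≤ cP) {η : ℝ} {k : ℕ} {Ω : ℕ → Set (Site d)}
    {Λs : ℕ → ℕ → Set (Site d)} {Λb : ℕ → ℕ → Set (Site d × Fin d)} (S : SockB9P3H2 (𝔸 := 𝔸) L B₀ B₀β cP β len η k Ω Λs Λb) :
    SockB9P3H2 (𝔸 := 𝔸) L B₀ B₀β cP' β len η k Ω Λs Λb :=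
  fun α₀ α₂ hα₀ hα₀c hα₂ hα₂c => S α₀ α₂ hα₀ (hα₀c.trans h) hα₂ (hα₂c.trans h)

end Socket

/-! ## §2 The univ-road member supplier and its family for `SockB9P3H2` (edition δ's proofs, line 5 from `HolderAtδ2`) -/

section Supply

variable [Nontrivial 𝔸]
variable {I : Type} (geo : I → B9.Geometry) (bg : I → B9.Backgrounds) (GA : ∀ i, B9.KernelFamily (geo i) (bg i))
variable (L : ℕ) (mem : ℝ → ZdIdx d L → ℕ → I)
variable (ιCfg : ∀ (M : ℝ) (i : ZdIdx d L) (m : ℕ) (U₀ : Site d → Fin d → 𝔸ˣ),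
  (∀ x κ, U₀ x κ ∈ unitaryUnits 𝔸) → (bg (mem M i m)).Cfg)
variable (ιLoc : ∀ (M : ℝ) (i : ZdIdx d L) (m : ℕ), (Site d → Fin d → 𝔸) → (geo (mem M i m)).Loc)
variable (ops : ℝ → ZdIdx d L → ℕ → OpsZd d 𝔸)

set_option maxHeartbeats 400000 in
/-- ★ **(EDITION δ₂: `HolderAtδ2` — Hölder class with BOTH points in `Ω_j`, fed (3.42) AND (3.43), constant `CH δ₀·(B₀ + max 0 (Bβ β))` —, socket `SockB9P3H2`; otherwise EDITION δ VERBATIM.)  AT A MEMBER WITH `Ω₀ = ℤᵈ` THEOREM 3.3 SUPPLIES THE FIVE-LINE SOCKET `SockB9P3H2`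
AT ANY SUPPLIED DATUM CLASS `ΛbP`** — `B9SupplySockB9P3ZdGammaUniv.sockB9P3P_at_univ` with the Δ′ bound taken at the datum's `α₀` from `InAk`; `B9SupplySockB9P3ZdAt.sockB9P3_at_univ'`
re-proved VERBATIM with the averaging datum class an explicit PARAMETER (binder `AvgAtP … ΛbP`, socket `SockB9P3 … ΛbP`) instead of the member's law field
`i.Λb` (at `Ω₀ = ℤᵈ` no locality law is needed: there is no exterior); same constants B₀′ = max{1, 2B₀max{1,q}}, B₀β′ = 2max{0, C_H Bβ(β)}max{1,q},
cP = min{1∕16, c₆∕M, a₀∕(K₆M), a₃∕(K₆M), 1∕(2B₀c₆₉K₆M+1)}.  At `ΛbP :=` print's class [B6] (2.3) ∕ (1.31) of the member this is EDITION γ of the univ-road member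
supplier (the law class `towerBonds` of the `Ω₀ = ℤᵈ` members of record is refuted at `m ≥ 1` by `B8SockB9P3ShellModeVacuityUniv.not_sB9all_idxB8SubB`).
[cite: Balaban1985RegularSpaces, (1.58)–(1.59) p.86, (1.31) p.82, Prop. 3 p.87, p.77; Balaban1985BackgroundPropagators, Thm 3.3 p.399, (3.26)–(3.27) p.395, (3.43), (3.47) p.398, (3.69) p.404; Balaban1984PropagatorsII, (2.3) p.224] -/
theorem sockB9P3PIδ2_at_univ (hd2 : 2 ≤ d) (hL : 1 ≤ L) {c35 c₆ K₆ a₃ c69 q β : ℝ} {CH : ℝ → ℝ} {len : Site d → ℝ}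
    {M : ℝ} (hM1 : 1 ≤ M) (i : ZdIdx d L) (hΩ : i.Ω 0 = Set.univ) (m : ℕ)
    (hdict : DictAt geo bg GA L mem ιCfg ιLoc ops M i m) (hP6 : Prop6At bg L mem ιCfg c35 c₆ K₆ M i m)
    (hinv : InvAt bg L mem ιCfg ops c35 a₃ M i m) (hcurv : CurvAtInAk L ops c69 M i m)
    (hlan : LandauAt bg L mem ιCfg ops c35 a₃ M i m)
    (ΛbP : ℕ → ℕ → Set (Site d × Fin d)) (havg : AvgAtP L ops q ΛbP M i m)
    (hhol : HolderAtδ2 geo bg GA L mem ιCfg ops β len CH M i m)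
    (hK₆ : 0 < K₆) (hc69 : 0 ≤ c69) (hq : 0 ≤ q)
    {B₀ δ₀ a₀ : ℝ} {Bβ Bε : ℝ → ℝ} {Bεβ : ℝ → ℝ → ℝ} (hB₀ : 0 < B₀) (hδ₀ : 0 < δ₀)
    (h33U : ∀ (α₀ : ℝ) (U₀ : Site d → Fin d → 𝔸ˣ) (hU₀ : ∀ x κ, U₀ x κ ∈ unitaryUnits 𝔸), 0 < α₀ → M * α₀ ≤ a₀ →
      (bg (mem M i m)).Reg335 c35 α₀ (ιCfg M i m U₀ hU₀) →
      B9.Ineq342_346_347 (GA (mem M i m)) B₀ δ₀ (ιCfg M i m U₀ hU₀) ∧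
        B9.Ineq343_345 (GA (mem M i m)) Bβ Bε Bεβ δ₀ (ιCfg M i m U₀ hU₀)) :
    SockB9P3H2 (𝔸 := 𝔸) L (max 1 (2 * B₀ * max 1 q)) (2 * max 0 (CH δ₀ * (B₀ + max 0 (Bβ β))) * max 1 q)
      (min (1 / 16) (min (c₆ / M) (min (a₀ / (K₆ * M)) (min (a₃ / (K₆ * M)) (1 / (2 * B₀ * c69 * M + 1))))))
      β len i.η m i.Ω i.Λs ΛbP := by
  intro α₀ α₂ hα₀ hα₀c hα₂ hα₂c U₀ W hU₀ hWu hInA _ hLanW A' _ h41 hA0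
  -- the thresholds
  have hη : 0 < i.η := i.hη
  have hLr : (1 : ℝ) ≤ L := by exact_mod_cast hL
  have hM0 : 0 < M := lt_of_lt_of_le one_pos hM1
  have hKM : 0 < K₆ * M := mul_pos hK₆ hM0
  simp only [le_min_iff] at hα₀c hα₂c
  obtain ⟨-, hα₀c6, hα₀a0, hα₀a3, hα₀θ⟩ := hα₀c
  obtain ⟨hα₂16, -, -, -, -⟩ := hα₂c
  have hc6 : M * α₀ ≤ c₆ := by rw [mul_comm]; exact (le_div_iff₀ hM0).1 hα₀c6
  have ha₉0 : 0 < K₆ * α₀ := mul_pos hK₆ hα₀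
  have ha0' : M * (K₆ * α₀) ≤ a₀ := by
    have h := (le_div_iff₀ hKM).1 hα₀a0
    calc M * (K₆ * α₀) = α₀ * (K₆ * M) := by ring
      _ ≤ a₀ := h
  have ha3' : M * (K₆ * α₀) ≤ a₃ := by
    have h := (le_div_iff₀ hKM).1 hα₀a3
    calc M * (K₆ * α₀) = α₀ * (K₆ * M) := by ring
      _ ≤ a₃ := h
  have hκ' : 0 ≤ c69 * M * α₀ := by positivity
  have hθ : B₀ * (c69 * M * α₀) ≤ 1 / 2 := by
    have hpos : 0 < 2 * B₀ * c69 * M + 1 := by positivity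
    have h1 : α₀ * (2 * B₀ * c69 * M + 1) ≤ 1 := (le_div_iff₀ hpos).1 hα₀θ
    linarith [hα₀.le]
  -- (3.35) for U₀ by Proposition 6, and Theorem 3.3's blocks for G(U₀)
  have hreg : (bg (mem M i m)).Reg335 c35 (K₆ * α₀) (ιCfg M i m U₀ hU₀) := hP6 α₀ U₀ hU₀ hα₀ hc6 hInA
  obtain ⟨h347, h345⟩ := h33U (K₆ * α₀) U₀ hU₀ ha₉0 ha0' hreg
  obtain ⟨-, hd⟩ := hdict
  -- A′ is a field of the class E(Ω₀) = E (every bond is a bond of Ω₀ = ℤᵈ)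
  have hU₀1 : ∀ x κ, U₀ x κ ∈ U1 𝔸 := fun x κ => unitaryUnits_le_U1 (hU₀ x κ)
  have hBT : ∀ (y : Site d) (τ : Fin d), BondTouches (i.Ω 0) y τ := fun y τ => Or.inl (by rw [hΩ]; exact Set.mem_univ y)
  have hAbd : Bdd L m i.η (-(1 : ℝ)) (fun j (b : Site d × Fin d) => SideTouches (i.Ω j) b.1 b.2) (fun b => A' b.1 b.2) := by
    have e1 : (-(1 : ℝ)) = -((1 : ℕ) : ℝ) := by norm_num
    rw [e1]
    refine B8ScaledSupNorm.bdd_of_forall (c := α₂) fun j hj b hb => ?_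
    rw [B8ScaledSupNorm.weight_neg_natCast, pow_one]
    have h := (h41 j hj b.1 b.2 hb).2
    have hs : 0 < (L : ℝ) ^ j * i.η := B8ScaledSupNorm.scale_pos hL hη j
    calc (L : ℝ) ^ j * i.η * ‖A' b.1 b.2‖ ≤ (L : ℝ) ^ j * i.η * (α₂ * ((L : ℝ) ^ j * i.η)⁻¹) :=
          mul_le_mul_of_nonneg_left h hs.le
      _ = α₂ := by rw [mul_comm α₂, ← mul_assoc, mul_inv_cancel₀ hs.ne', one_mul]
  have hOn : OnDom L m i.η i.Ω A' := ⟨fun y τ h => absurd (hBT y τ) h, hAbd⟩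
  obtain ⟨a, ha_def⟩ : ∃ a : ℝ,
      a = msup L m i.η (-(1 : ℝ)) (fun j (b : Site d × Fin d) => SideTouches (i.Ω j) b.1 b.2) (fun b => A' b.1 b.2) :=
    ⟨_, rfl⟩
  have ha0 : 0 ≤ a := by rw [ha_def]; exact B8ScaledSupNorm.msup_nonneg L m hη.le _ _ _
  -- the Landau condition for A′; the source J̃ = Δ_a(U₀)A′ and A′ = G(U₀)J̃ ((1.58))
  have hLanA : IsLandau138 L m i.η (i.Ω 0) (i.Λs m) U₀ A' := B9SupplySockB9P3Zd.landau_of_landauW hd2 hη U₀ hWu hα₂16 h41 hLanW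
  obtain ⟨Jt, hJt_def⟩ : ∃ Jt : Site d → Fin d → 𝔸, Jt = deltaAOf i.η (ops M i m) U₀ A' := ⟨_, rfl⟩
  have hGJ : (ops M i m).Gop U₀ Jt = A' :=
    hinv (K₆ * α₀) U₀ hU₀ ha₉0 ha3' hreg A' hOn Jt fun y τ _ => by rw [hJt_def]
  have hDRD : ∀ (x : Site d) (μ : Fin d), (ops M i m).DRDs U₀ A' x μ = 0 :=
    hlan (K₆ * α₀) U₀ hU₀ ha₉0 ha3' hreg A' hOn hLanA
  have hJtb : ∀ (x : Site d) (μ : Fin d),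
      Jt x μ = Jcur i.η U₀ A' μ x + (ops M i m).Dp U₀ A' x μ + (ops M i m).DRDs U₀ A' x μ + (ops M i m).QQ U₀ A' x μ := by
    intro x μ; rw [hJt_def]; rfl
  -- the right-hand side of the socket: |J|₍₋₃₎ and |B₁|
  obtain ⟨nJ, hnJ_def⟩ : ∃ nJ : ℝ, nJ = bondNorm L m i.η (-(3 : ℝ)) i.Ω (fun x μ => Jcur i.η U₀ A' μ x) := ⟨_, rfl⟩
  obtain ⟨nB, hnB_def⟩ : ∃ nB : ℝ, nB = wsup 1 (fun p : {p : ℕ × (Site d × Fin d) // p.1 ≤ m ∧ p.2 ∈ ΛbP m p.1} =>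
      linCovIter L U₀ (iEta i.η A') p.1.1 p.1.2.1 p.1.2.2) := ⟨_, rfl⟩
  have hnJ0 : 0 ≤ nJ := by rw [hnJ_def]; exact B8ScaledSupNorm.msup_nonneg L m hη.le _ _ _
  have hnB0 : 0 ≤ nB := by rw [hnB_def]; exact B8Eq155JBound.wsup_nonneg zero_le_one _
  -- J is bounded (A′ is)
  have hAglob : ∀ (y : Site d) (τ : Fin d), ‖A' y τ‖ ≤ α₂ * i.η⁻¹ := by
    intro y τ
    by_cases hmem : ∃ j, j ≤ m ∧ SideTouches (i.Ω j) y τ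
    · obtain ⟨j, hj, hs⟩ := hmem
      have hLj : (1 : ℝ) ≤ (L : ℝ) ^ j := one_le_pow₀ hLr
      calc ‖A' y τ‖ ≤ α₂ * ((L : ℝ) ^ j * i.η)⁻¹ := (h41 j hj y τ hs).2
        _ = α₂ * i.η⁻¹ * ((L : ℝ) ^ j)⁻¹ := by rw [mul_inv]; ring
        _ ≤ α₂ * i.η⁻¹ * 1 := by
            apply mul_le_mul_of_nonneg_left (inv_le_one_of_one_le₀ hLj) (by positivity)
        _ = α₂ * i.η⁻¹ := mul_one _
    · rw [hA0 y τ fun j hj hs => hmem ⟨j, hj, hs⟩, norm_zero]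
      positivity
  have hgrad : ∀ (y : Site d) (κ τ : Fin d), ‖covDerivFwd i.η U₀ κ (fun z => A' z τ) y‖ ≤ i.η⁻¹ * (α₂ * i.η⁻¹ + α₂ * i.η⁻¹) :=
    fun y κ τ => (B9SupplySockB9P3ZdLettersOmega.norm_covDerivFwd_le hη (hU₀1 _ _) _).trans
      (mul_le_mul_of_nonneg_left (add_le_add (hAglob _ _) (hAglob _ _)) (inv_nonneg.mpr hη.le))
  have hJbd : Bdd L m i.η (-(3 : ℝ)) (fun j (b : Site d × Fin d) => BondTouches (i.Ω j) b.1 b.2)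
      (fun b => Jcur i.η U₀ A' b.2 b.1) :=
    B9SupplySockB9P3Zd.bdd_neg_three_of_pointwise hL hη fun b => B9SupplySockB9P3Zd.norm_Jcur_le_of_grad hη hU₀1 hgrad b.2 b.1
  -- |J̃|₍₋₃₎ ≤ |J|₍₋₃₎ + c₆₉ M α₀ |A′|₍₋₁₎ + q |B₁| (pointwise: (3.26) with (3.69), the Landau condition, (3.16))
  have hJt : bondNorm L m i.η (-(3 : ℝ)) i.Ω Jt ≤ nJ + c69 * M * α₀ * a + q * nB := by
    have e3 : (-(3 : ℝ)) = -((3 : ℕ) : ℝ) := by norm_num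
    refine B8ScaledSupNorm.msup_le (by positivity) fun j hj b hb => ?_
    have hw : weight L i.η (-(3 : ℝ)) j = ((L : ℝ) ^ j * i.η) ^ 3 := by
      rw [e3, B8ScaledSupNorm.weight_neg_natCast]
    have hw0 : 0 ≤ ((L : ℝ) ^ j * i.η) ^ 3 := by positivity
    have h1 : weight L i.η (-(3 : ℝ)) j * ‖Jcur i.η U₀ A' b.2 b.1‖ ≤ nJ := by
      rw [hnJ_def]; exact B8ScaledSupNorm.weight_mul_norm_le_msup hJbd hj hb
    have h2 : ((L : ℝ) ^ j * i.η) ^ 3 * ‖(ops M i m).Dp U₀ A' b.1 b.2‖ ≤ c69 * M * α₀ * a := by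
      rw [ha_def]; exact hcurv α₀ U₀ hU₀ hα₀ hInA A' hOn j hj b.1 b.2 hb
    have h4 : ((L : ℝ) ^ j * i.η) ^ 3 * ‖(ops M i m).QQ U₀ A' b.1 b.2‖ ≤ q * nB := by
      rw [hnB_def]; exact havg U₀ hU₀ A' hOn j hj b.1 b.2 hb
    have hsum : ‖Jt b.1 b.2‖ ≤
        ‖Jcur i.η U₀ A' b.2 b.1‖ + ‖(ops M i m).Dp U₀ A' b.1 b.2‖ + ‖(ops M i m).QQ U₀ A' b.1 b.2‖ := by
      rw [hJtb, hDRD b.1 b.2, add_zero]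
      exact norm_add₃_le
    rw [hw] at h1 ⊢
    calc ((L : ℝ) ^ j * i.η) ^ 3 * ‖Jt b.1 b.2‖
        ≤ ((L : ℝ) ^ j * i.η) ^ 3 *
            (‖Jcur i.η U₀ A' b.2 b.1‖ + ‖(ops M i m).Dp U₀ A' b.1 b.2‖ + ‖(ops M i m).QQ U₀ A' b.1 b.2‖) :=
          mul_le_mul_of_nonneg_left hsum hw0
      _ = ((L : ℝ) ^ j * i.η) ^ 3 * ‖Jcur i.η U₀ A' b.2 b.1‖ + ((L : ℝ) ^ j * i.η) ^ 3 * ‖(ops M i m).Dp U₀ A' b.1 b.2‖ +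
            ((L : ℝ) ^ j * i.η) ^ 3 * ‖(ops M i m).QQ U₀ A' b.1 b.2‖ := by ring
      _ ≤ nJ + c69 * M * α₀ * a + q * nB := add_le_add (add_le_add h1 h2) h4
  -- Theorem 3.3's γ = −3 entries at J̃ through the dictionary ((3.47) ⇒ (1.59)), and the Hölder binder
  obtain ⟨hw, hG0, hG1, hG3⟩ := hd U₀ hU₀ Jt
  have hline1 : a ≤ B₀ * bondNorm L m i.η (-(3 : ℝ)) i.Ω Jt := by
    have h := B9.glob_at_minus_three (GA (mem M i m)) h347 0 (ιLoc M i m Jt)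
    rw [hG0, hw, hGJ, ← ha_def] at h
    exact h
  have hline2 : msup L m i.η (-(2 : ℝ)) (fun j (t : Fin d × Fin d × Site d) => SideTouches (i.Ω j) t.2.2 t.2.1)
      (fun t => covDerivFwd i.η U₀ t.1 (fun z => A' z t.2.1) t.2.2) ≤ B₀ * bondNorm L m i.η (-(3 : ℝ)) i.Ω Jt := by
    have h := B9.glob_at_minus_three (GA (mem M i m)) h347 1 (ιLoc M i m Jt)
    rw [hG1, hw, hGJ] at h
    exact h
  have hline4 : bondNorm L m i.η (-(3 : ℝ)) i.Ω (fun x μ => covLap i.η U₀ (fun z => A' z μ) x) ≤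
      B₀ * bondNorm L m i.η (-(3 : ℝ)) i.Ω Jt := by
    have h := B9.glob_at_minus_three (GA (mem M i m)) h347 3 (ιLoc M i m Jt)
    rw [hG3, hw, hGJ] at h
    exact h
  have hline5 : msup L m i.η (-(2 + β))
      (fun j (q : Fin d × Fin d × (Site d × Site d)) => q.2.2 ∈ AdmPair i.η len ∧ q.2.2.1 ∈ i.Ω j ∧ q.2.2.2 ∈ i.Ω j)
      (fun q => hquot i.η β len U₀ (covDerivFwd i.η U₀ q.1 (fun z => A' z q.2.1)) q.2.2) ≤
      max 0 (CH δ₀ * (B₀ + max 0 (Bβ β))) * bondNorm L m i.η (-(3 : ℝ)) i.Ω Jt := by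
    have h := hhol Bβ Bε Bεβ δ₀ B₀ U₀ hU₀ hδ₀ h347 h345 Jt
    rw [hGJ] at h
    exact h.trans (mul_le_mul_of_nonneg_right (le_max_right _ _) (B8ScaledSupNorm.msup_nonneg L m hη.le _ _ _))
  -- the a-priori (Neumann) step of G-IF-01, in the concrete norms
  have hJJ : bondNorm L m i.η (-(3 : ℝ)) i.Ω (fun x μ => pdiv i.η U₀ (plaqCovDeriv i.η U₀ A') μ x) = nJ := by
    rw [hnJ_def]; rfl
  rw [← ha_def, ← hnJ_def, ← hnB_def]
  exact B9SupplySockB9P3Zd.apriori_arith hB₀ hq hκ' hθ ha0 hnJ0 hnB0 (le_max_left 0 _) hJJ hJt hline1 hline2 hline4 hline5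


/-- ★ **(EDITION δ₂; EXPLICIT CONSTANTS, SUPPLIED CLASS.)  THE `SB9all`-TYPE FAMILY (socket `SockB9P3H2`) AT THE `Ω₀ = ℤᵈ` MEMBERS AT A MEMBER-WISE DATUM CLASS `ΛbP j`** — edition γ of
`B9SupplySockB9P3ZdAtJoint.sockB9P3_allLevels_univ_explicit_on` (binder `AvgAtP … (ΛbP j)`, socket `SockB9P3 … (ΛbP j)`).
[cite: Balaban1985RegularSpaces, (1.59) p.86, (1.31) p.82, p.77; Balaban1985BackgroundPropagators, Thm 3.3 p.399; Balaban1984PropagatorsII, (2.3) p.224] -/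
theorem sockB9P3PIδ2_allLevels_univ_explicit_on (hd2 : 2 ≤ d) (hL : 1 ≤ L) {c35 c₆ K₆ M₃ a₃ c69 q β : ℝ} {CH : ℝ → ℝ} {len : Site d → ℝ}
    {M₁ δ₀ a₀ B₀ : ℝ} {Bβ Bε : ℝ → ℝ} {Bεβ : ℝ → ℝ → ℝ} (hB₀ : 0 < B₀) (hδ₀ : 0 < δ₀)
    (H : ∀ i : I, M₁ ≤ (geo i).M → ∀ α₀ : ℝ, 0 < α₀ → (geo i).M * α₀ ≤ a₀ →
      ∀ U : (bg i).Cfg, (bg i).Reg335 c35 α₀ U →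
        B9.Ineq342_346_347 (GA i) B₀ δ₀ U ∧ B9.Ineq343_345 (GA i) Bβ Bε Bεβ δ₀ U)
    {M : ℝ} (hM1 : 1 ≤ M) (hMM₁ : M₁ ≤ M) (hMM₃ : M₃ ≤ M)
    {J : Type*} (ι : J → ZdIdx d L) (hΩJ : ∀ j, (ι j).Ω 0 = Set.univ)
    (hdict : ∀ (M : ℝ) (j : J) (m : ℕ), DictAt geo bg GA L mem ιCfg ιLoc ops M (ι j) m)
    (hP6 : ∀ (M : ℝ) (j : J) (m : ℕ), M₃ ≤ M → Prop6At bg L mem ιCfg c35 c₆ K₆ M (ι j) m)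
    (hinv : ∀ (M : ℝ) (j : J) (m : ℕ), M₃ ≤ M → InvAt bg L mem ιCfg ops c35 a₃ M (ι j) m)
    (hcurv : ∀ (M : ℝ) (j : J) (m : ℕ), M₃ ≤ M → CurvAtInAk L ops c69 M (ι j) m)
    (hlan : ∀ (M : ℝ) (j : J) (m : ℕ), M₃ ≤ M → LandauAt bg L mem ιCfg ops c35 a₃ M (ι j) m)
    (ΛbP : J → ℕ → ℕ → Set (Site d × Fin d)) (havg : ∀ (M : ℝ) (j : J) (m : ℕ), AvgAtP L ops q (ΛbP j) M (ι j) m)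
    (hhol : ∀ (M : ℝ) (j : J) (m : ℕ), HolderAtδ2 geo bg GA L mem ιCfg ops β len CH M (ι j) m)
    (hK₆ : 0 < K₆) (hc69 : 0 ≤ c69) (hq : 0 ≤ q) :
    ∀ (j : J) (m : ℕ), m ≤ (ι j).k →
      SockB9P3H2 (𝔸 := 𝔸) L (max 1 (2 * B₀ * max 1 q)) (2 * max 0 (CH δ₀ * (B₀ + max 0 (Bβ β))) * max 1 q)
        (min (1 / 16) (min (c₆ / M) (min (a₀ / (K₆ * M)) (min (a₃ / (K₆ * M)) (1 / (2 * B₀ * c69 * M + 1))))))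
        β len (ι j).η m (ι j).Ω (ι j).Λs (ΛbP j) := by
  intro j m _
  refine sockB9P3PIδ2_at_univ geo bg GA L mem ιCfg ιLoc ops hd2 hL hM1 (ι j) (hΩJ j) m (hdict M j m) (hP6 M j m hMM₃) (hinv M j m hMM₃)
    (hcurv M j m hMM₃) (hlan M j m hMM₃) (ΛbP j) (havg M j m) (hhol M j m) hK₆ hc69 hq
    (δ₀ := δ₀) (Bε := Bε) (Bεβ := Bεβ) hB₀ hδ₀ fun α₀ U₀ hU₀ hα₀ hMa hreg => ?_
  have hMi : M₁ ≤ (geo (mem M (ι j) m)).M := by rw [(hdict M j m).1]; exact hMM₁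
  have hMa' : (geo (mem M (ι j) m)).M * α₀ ≤ a₀ := by rw [(hdict M j m).1]; exact hMa
  exact H (mem M (ι j) m) hMi α₀ hα₀ hMa' (ιCfg M (ι j) m U₀ hU₀) hreg


end Supply

/-! ## §3 A6: the witness of edition δ at truncation `0` inhabits `HolderAtδ2` too -/

section Main

open B9SupplySockB9P3ZdBeta.Witness (massA bgW)
open B9SupplySockB9P3ZdUnivWitness

section FrameFacts

variable {𝔸₀ : Type} [CStarAlgebra 𝔸₀] [Nontrivial 𝔸₀]
variable {L : ℕ} (i : ZdIdx d L) (hd : 1 ≤ d)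

/-- **The (3.42)∕(3.47) block of the witness frame PINS `B₀ ≥ 0`**: the frame's local entries vanish and `pref4 η 0 > 0`, `supNorm = 1`, so the `n = 0` local
inequality reads `0 ≤ B₀·pref·e^{−δ₀d}`. [cite: Balaban1985BackgroundPropagators, (3.42) p.397] -/
theorem B0_nonneg_of_ineq342 {B₀ δ₀ : ℝ} {U : Site d → Fin d → 𝔸₀ˣ} (h : B9.Ineq342_346_347 (GAU i hd) B₀ δ₀ U) : 0 ≤ B₀ := by
  have hη : 0 < i.η := i.hη
  have h1 := h.1 0 (fun _ _ => (0 : 𝔸₀)) () () trivial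
  rw [(GAU_readings i hd).1, geoU_len, (geoU_readings i).2.2.2.1, (geoU_readings i).1, mul_zero, neg_zero, Real.exp_zero, mul_one, mul_one] at h1
  have hp : 0 < B9.pref4 i.η 0 := by simp [B9.pref4]; positivity
  by_contra hB
  have hB' : B₀ < 0 := not_le.1 hB
  have : B₀ * B9.pref4 i.η 0 < 0 := mul_neg_of_neg_of_pos hB' hp
  linarith

/-- **The witness's Hölder line over the both-points class** (`holder_line` verbatim: only the admissibility conjunct is used). [cite: Balaban1985RegularSpaces, Prop. 3 p.87; Balaban1985BackgroundPropagators, (3.43) p.398] -/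
theorem holder_line2 (hΩ : i.Ω 0 = Set.univ) {β : ℝ} (hβ : 0 ≤ β) {len : Site d → ℝ} (hlen : ∀ v : Site d, 0 < len v → 1 ≤ len v)
    {U : Site d → Fin d → 𝔸₀ˣ} (hU : ∀ x κ, U x κ ∈ unitaryUnits 𝔸₀) (J : Site d → Fin d → 𝔸₀) :
    msup L 0 i.η (-(2 + β)) (fun j (q : Fin d × Fin d × (Site d × Site d)) => q.2.2 ∈ AdmPair i.η len ∧ q.2.2.1 ∈ i.Ω j ∧ q.2.2.2 ∈ i.Ω j)
        (fun q => hquot i.η β len U (covDerivFwd i.η U q.1 (fun z => (opsU hd i.η i.hη).Gop U J z q.2.1)) q.2.2)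
      ≤ bondNorm L 0 i.η (-(3 : ℝ)) i.Ω J := by
  have hη : 0 < i.η := i.hη
  have hdpos : (0 : ℝ) < d := by exact_mod_cast hd
  have hd1 : (1 : ℝ) ≤ d := by exact_mod_cast hd
  set W := bondNorm L 0 i.η (-(3 : ℝ)) i.Ω J with hW
  have hW0 : 0 ≤ W := B8ScaledSupNorm.msup_nonneg L 0 hη.le _ _ _
  have hU1 : ∀ y κ, U y κ ∈ U1 𝔸₀ := fun y κ => unitaryUnits_le_U1 (hU y κ)
  have hG : ∀ (x : Site d) (μ : Fin d), ‖(opsU hd i.η i.hη).Gop U J x μ‖ ≤ W / (16 * d * i.η) := fun x μ =>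
    norm_Gop_le_W i hd hΩ hU J x μ
  have hgrad : ∀ (μ ν : Fin d) (y : Site d), ‖covDerivFwd i.η U μ (fun z => (opsU hd i.η i.hη).Gop U J z ν) y‖ ≤
      i.η⁻¹ * (W / (16 * d * i.η) + W / (16 * d * i.η)) := fun μ ν y =>
    (B9SupplySockB9P3ZdLettersOmega.norm_covDerivFwd_le hη (hU1 _ _) _).trans
      (mul_le_mul_of_nonneg_left (add_le_add (hG _ _) (hG _ _)) (inv_nonneg.mpr hη.le))
  have hwt : weight L i.η (-(2 + β)) 0 = i.η ^ (2 + β) := by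
    simp only [weight, pow_zero, one_mul, neg_neg]
  have hηβ : 0 < i.η ^ β := Real.rpow_pos_of_pos hη β
  have hsplit : i.η ^ (2 + β) = i.η ^ 2 * i.η ^ β := by
    rw [Real.rpow_add hη, Real.rpow_two]
  refine B8ScaledSupNorm.msup_le hW0 fun j hj q hq => ?_
  obtain rfl : j = 0 := Nat.le_zero.mp hj
  rw [hwt]
  have hqt := hquot_le_of_bound hη hβ hlen hU1 (hgrad q.1 q.2.1) hq.1
  have hnn : 0 ≤ hquot i.η β len U (covDerivFwd i.η U q.1 fun z => (opsU hd i.η i.hη).Gop U J z q.2.1) q.2.2 :=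
    B9Eq340HolderZd.hquot_nonneg hη.le β U _ hq.1
  rw [Real.norm_of_nonneg hnn]
  calc i.η ^ (2 + β) * hquot i.η β len U (covDerivFwd i.η U q.1 fun z => (opsU hd i.η i.hη).Gop U J z q.2.1) q.2.2
      ≤ i.η ^ (2 + β) * (2 * (i.η⁻¹ * (W / (16 * d * i.η) + W / (16 * d * i.η))) * (i.η ^ β)⁻¹) :=
        mul_le_mul_of_nonneg_left hqt (by positivity)
    _ = i.η ^ 2 * (2 * (i.η⁻¹ * (W / (16 * d * i.η) + W / (16 * d * i.η)))) * (i.η ^ β * (i.η ^ β)⁻¹) := by rw [hsplit]; ring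
    _ = W / (4 * d) := by rw [mul_inv_cancel₀ hηβ.ne', mul_one]; field_simp; ring
    _ ≤ W := by rw [div_le_iff₀ (by positivity)]; nlinarith

end FrameFacts

variable {𝔸₀ : Type} [CStarAlgebra 𝔸₀] [Nontrivial 𝔸₀]
variable {L : ℕ}

/-- ★★ **A6 WITNESS, EDITION δ₂: THE HYPOTHESIS SET OF `sockB9P3PIδ2_at_univ` (AND THE TEN-LETTER SET OF EDITION δ's SOURCED ROAD, WITH `HolderAtδ2`) IS INHABITED AT EVERY MEMBER WITH `Ω 0 = ℤᵈ`, TRUNCATION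
`m = 0`, FOR EVERY DATUM CLASS `ΛbP` WHOSE LEVEL-`0` SET AT TRUNCATION `0` IS ALL BONDS** (`d ≥ 2`, `0 ≤ β < 1`, a length with «non-zero admissible displacement
⇒ ≥ 1»; any nontrivial C⋆-algebra `𝔸₀ : Type`): `DictAt ∧ Prop6At ∧ InvAt ∧ CurvAt ∧ LandauAt ∧ AvgAtP … ΛbP ∧ HolderAt ∧ LinBddAt ∧ SrcAt ∧ SrcHolderAt` at
`(1, i, 0)` and BOTH blocks of Theorem 3.3 — `B9SupplySockB9P3ZdAtLin.binders_inhabited_univ_zero_lin` VERBATIM with the class a parameter (letters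
`B9SupplySockB9P3ZdUnivWitness.opsU`, frame `geoU ∕ bgW ∕ GAU`, by import).  Print's class at truncation `0` (every bond has an end-point in `Λ₀^{(0)} = ℤᵈ`)
qualifies. [cite: Balaban1985BackgroundPropagators, Thm 3.3 p.399, (3.20)–(3.27) pp.394–395, (3.47) p.398, (3.16) p.393; Balaban1985RegularSpaces, Thm 8 + (1.146) p.101, (1.58)–(1.59) p.86, (1.31) p.82, p.77; Balaban1984PropagatorsII, (2.3) p.224] -/
theorem binders_inhabited_univ_zero_linPIδ2 (hd2 : 2 ≤ d) (i : ZdIdx d L) (hΩ : i.Ω 0 = Set.univ)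
    (ΛbP : ℕ → ℕ → Set (Site d × Fin d)) (hΛb : ∀ b : Site d × Fin d, b ∈ ΛbP 0 0) {β : ℝ} (hβ0 : 0 ≤ β) (hβ1 : β < 1) {len : Site d → ℝ}
    (hlen : ∀ v : Site d, 0 < len v → 1 ≤ len v) :
    ∃ (I : Type) (geo : I → B9.Geometry) (bg : I → B9.Backgrounds) (GA : ∀ x, B9.KernelFamily (geo x) (bg x))
      (mem : ℝ → ZdIdx d L → ℕ → I)
      (ιCfg : ∀ (M : ℝ) (i' : ZdIdx d L) (m : ℕ) (U₀ : Site d → Fin d → 𝔸₀ˣ), (∀ x κ, U₀ x κ ∈ unitaryUnits 𝔸₀) → (bg (mem M i' m)).Cfg)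
      (ιLoc : ∀ (M : ℝ) (i' : ZdIdx d L) (m : ℕ), (Site d → Fin d → 𝔸₀) → (geo (mem M i' m)).Loc)
      (ops : ℝ → ZdIdx d L → ℕ → OpsZd d 𝔸₀) (c35 c₆ K₆ a₃ c69 q cS cSβ B₀ δ₀ a₀ : ℝ) (CH Bβ Bε : ℝ → ℝ) (Bεβ : ℝ → ℝ → ℝ),
      0 < K₆ ∧ 0 ≤ c69 ∧ 0 ≤ q ∧ 0 ≤ cS ∧ 0 ≤ cSβ ∧ 0 < B₀ ∧ 0 < c₆ ∧ 0 < a₃ ∧ 0 < a₀ ∧ (∀ δ, 0 ≤ CH δ) ∧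
      DictAt geo bg GA L mem ιCfg ιLoc ops 1 i 0 ∧ Prop6At bg L mem ιCfg c35 c₆ K₆ 1 i 0 ∧ InvAt bg L mem ιCfg ops c35 a₃ 1 i 0 ∧
      CurvAtInAk L ops c69 1 i 0 ∧ LandauAt bg L mem ιCfg ops c35 a₃ 1 i 0 ∧ AvgAtP L ops q ΛbP 1 i 0 ∧
      HolderAtδ2 geo bg GA L mem ιCfg ops β len CH 1 i 0 ∧ LinBddAt L ops 1 i 0 ∧ SrcAt bg L mem ιCfg ops c35 a₃ cS 1 i 0 ∧
      SrcHolderAt bg L mem ιCfg ops c35 a₃ β len cSβ 1 i 0 ∧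
      (∀ (α₀ : ℝ) (U₀ : Site d → Fin d → 𝔸₀ˣ) (hU₀ : ∀ x κ, U₀ x κ ∈ unitaryUnits 𝔸₀), 0 < α₀ → 1 * α₀ ≤ a₀ →
        (bg (mem 1 i 0)).Reg335 c35 α₀ (ιCfg 1 i 0 U₀ hU₀) →
        B9.Ineq342_346_347 (GA (mem 1 i 0)) B₀ δ₀ (ιCfg 1 i 0 U₀ hU₀) ∧
          B9.Ineq343_345 (GA (mem 1 i 0)) Bβ Bε Bεβ δ₀ (ιCfg 1 i 0 U₀ hU₀)) := by
  classical
  have hd : 1 ≤ d := le_trans one_le_two hd2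
  have hη : 0 < i.η := i.hη
  have hdpos : (0 : ℝ) < d := by exact_mod_cast hd
  have ha : 0 < massA d i.η := by unfold massA; positivity
  have hbt : ∀ (y : Site d) (τ : Fin d), BondTouches (i.Ω 0) y τ := fun y τ => Or.inl (by rw [hΩ]; trivial)
  -- the value of G(U₀) at the ZERO source (the source term `G(U₀)DRD*A` of the witness, `DRD* := 0`)
  have hG0 : ∀ (U₀ : Site d → Fin d → 𝔸₀ˣ), (∀ x κ, U₀ x κ ∈ unitaryUnits 𝔸₀) →
      (opsU hd i.η hη).Gop U₀ (fun _ _ => (0 : 𝔸₀)) = fun _ _ => 0 := by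
    intro U₀ hU₀
    have hb0 : BddF (fun (_ : Site d) (_ : Fin d) => (0 : 𝔸₀)) := ⟨0, fun _ _ => by simp⟩
    have hr : restrU (fun (_ : Site d) (_ : Fin d) => (0 : 𝔸₀)) = 0 := by
      ext b; rw [restrU_apply hb0]; rfl
    rw [opsU_Gop hd hη hU₀, hr, fpU_zero hd hη hU₀, extdU_zero]; rfl
  refine ⟨Unit, fun _ => geoU i, fun _ => bgW d 𝔸₀, fun _ => GAU i hd, fun _ _ _ => (), fun _ _ _ U₀ _ => U₀, fun _ _ _ J => J,
    fun _ _ _ => opsU hd i.η i.hη, 0, 1, 1, 1, 0, massA d i.η * i.η ^ 2, 0, 0, 1, 0, 1, fun _ => 1, fun _ => 1, fun _ => 1, fun _ _ => 1,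
    one_pos, le_rfl, by positivity, le_rfl, le_rfl, one_pos, one_pos, one_pos, one_pos, fun _ => zero_le_one, ?_, ?_, ?_, ?_, ?_, ?_, ?_, ?_, ?_, ?_, ?_⟩
  · -- the norm dictionary: by construction of the frame
    refine ⟨rfl, fun U₀ hU₀ J => ⟨?_, ?_, ?_, ?_⟩⟩
    · rw [(geoU_readings i).2.2.2.2.2.2, if_pos rfl]
    · rw [(GAU_readings i hd).2.2.2.2.2, if_pos rfl]; simp [globU]
    · rw [(GAU_readings i hd).2.2.2.2.2, if_pos rfl]; simp [globU]
    · rw [(GAU_readings i hd).2.2.2.2.2, if_pos rfl]; simp [globU]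
  · -- Proposition 6's class: `Reg335 := ⊤`
    intro _ _ _ _ _ _; trivial
  · -- (3.27): G(U₀) is a left inverse of Δ_a(U₀) = D*_{U₀}D_{U₀} + a on E(ℤᵈ) = the bounded fields
    intro α₀ U₀ hU₀ _ _ _ A hA J hJ
    obtain ⟨c, hc⟩ := hA.2
    have e1 : (-(1 : ℝ)) = -((1 : ℕ) : ℝ) := by norm_num
    have hw1 : weight L i.η (-(1 : ℝ)) 0 = i.η := by rw [e1, B8ScaledSupNorm.weight_neg_natCast, pow_zero, one_mul, pow_one]
    have hAb : BddF A := by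
      refine ⟨c / i.η, fun y τ => ?_⟩
      have h := hc 0 le_rfl (y, τ) (sideTouches_univ i hd2 hΩ y τ)
      rw [hw1] at h
      rw [le_div_iff₀ hη, mul_comm]; exact h
    have hJ' : ∀ (y : Site d) (τ : Fin d), J y τ = Jcur i.η U₀ A τ y + (massA d i.η : ℂ) • A y τ := by
      intro y τ
      rw [hJ y τ (hbt y τ)]
      simp [deltaAOf, opsU]
    have hfix := fpU_unique hd hη hU₀ (restrU J) (phiU_restr_of_eq hd hη hU₀ hAb hJ')
    show (opsU hd i.η i.hη).Gop U₀ J = A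
    rw [opsU_Gop hd hη hU₀, ← hfix, extdU_restrU hAb]
  · -- (3.69): `Δ′ := 0`
    intro α₀ U₀ hU₀ hα₀ _ A _ j _ x μ _
    show ((L : ℝ) ^ j * i.η) ^ 3 * ‖(0 : 𝔸₀)‖ ≤ 0 * 1 * α₀ * _
    simp
  · -- the Landau letter: `DRD* := 0`
    intro _ _ _ _ _ _ _ _ _ _ _; rfl
  · -- (3.16): `Q*aQ := a·1`, `q := aη²`; every bond is a level-0 constraint bond at truncation 0
    intro U₀ hU₀ A hA j hj x μ hb
    obtain rfl : j = 0 := Nat.le_zero.mp hj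
    show ((L : ℝ) ^ 0 * i.η) ^ 3 * ‖(massA d i.η : ℂ) • A x μ‖ ≤ _
    obtain ⟨c, hc⟩ := hA.2
    have e1 : (-(1 : ℝ)) = -((1 : ℕ) : ℝ) := by norm_num
    have hw1 : weight L i.η (-(1 : ℝ)) 0 = i.η := by rw [e1, B8ScaledSupNorm.weight_neg_natCast, pow_zero, one_mul, pow_one]
    have hnormA : ∀ (y : Site d) (τ : Fin d), i.η * ‖A y τ‖ ≤ c := fun y τ => by
      have := hc 0 le_rfl (y, τ) (sideTouches_univ i hd2 hΩ y τ); rwa [hw1] at this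
    have hbd : ∀ p : {p : ℕ × (Site d × Fin d) // p.1 ≤ 0 ∧ p.2 ∈ ΛbP 0 p.1},
        1 * ‖linCovIter L U₀ (iEta i.η A) p.1.1 p.1.2.1 p.1.2.2‖ ≤ c := by
      rintro ⟨⟨j', b⟩, hj', -⟩
      obtain rfl : j' = 0 := Nat.le_zero.mp hj'
      dsimp only
      rw [one_mul, B7Prop4GeneralLevels.linCovIter_zero, iEta, norm_smul, norm_mul, Complex.norm_I, one_mul, Complex.norm_real,
        Real.norm_of_nonneg hη.le]
      exact hnormA b.1 b.2
    have hle := B8Eq155JBound.le_wsup hbd ⟨(0, (x, μ)), le_rfl, hΛb (x, μ)⟩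
    dsimp only at hle
    rw [one_mul, B7Prop4GeneralLevels.linCovIter_zero, iEta, norm_smul, norm_mul, Complex.norm_I, one_mul, Complex.norm_real,
      Real.norm_of_nonneg hη.le] at hle
    rw [pow_zero, one_mul, norm_smul, Complex.norm_real, Real.norm_of_nonneg ha.le]
    calc i.η ^ 3 * (massA d i.η * ‖A x μ‖) = (massA d i.η * i.η ^ 2) * (i.η * ‖A x μ‖) := by ring
      _ ≤ (massA d i.η * i.η ^ 2) * _ := mul_le_mul_of_nonneg_left hle (by positivity)
  · -- the Hölder binder (edition δ₂): (3.43)'s block pins `Bβ β ≥ 1`, (3.42)'s block pins `B₀ ≥ 0`; the crude quotient bound gives `≤ |J|₍₋₃₎`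
    intro Bβ Bε Bεβ δ₀ B₀ U₀ hU₀ _ h342 h343 J
    show _ ≤ 1 * (B₀ + max 0 (Bβ β)) * bondNorm L 0 i.η (-(3 : ℝ)) i.Ω J
    have hB : 1 ≤ Bβ β := one_le_of_ineq343 i hd h343 hβ0 hβ1
    have hB0 : 0 ≤ B₀ := B0_nonneg_of_ineq342 i hd h342
    have hBB : 1 ≤ B₀ + max 0 (Bβ β) := by
      have : Bβ β ≤ max 0 (Bβ β) := le_max_right _ _
      linarith
    have hW0 : 0 ≤ bondNorm L 0 i.η (-(3 : ℝ)) i.Ω J := B8ScaledSupNorm.msup_nonneg L 0 hη.le _ _ _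
    calc _ ≤ bondNorm L 0 i.η (-(3 : ℝ)) i.Ω J := holder_line2 i hd hΩ hβ0 hlen hU₀ J
      _ = 1 * 1 * bondNorm L 0 i.η (-(3 : ℝ)) i.Ω J := by ring
      _ ≤ 1 * (B₀ + max 0 (Bβ β)) * bondNorm L 0 i.η (-(3 : ℝ)) i.Ω J := by gcongr
  · -- ★ the guarded letter: `G(U₀)` additive on BOUNDED sources (`opsU_Gop_add_of_bdd`), and `DRD* := 0` is bounded
    exact ⟨fun U₀ hU₀ J₁ J₂ h₁ h₂ => opsU_Gop_add_of_bdd hd hη hU₀ h₁ h₂,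
      fun U₀ _ A _ => ⟨0, fun x μ => by rw [show (opsU hd i.η i.hη).DRDs U₀ A x μ = (0 : 𝔸₀) from rfl, norm_zero]⟩⟩
  · -- the source term through `G(U₀)DRD*A = G(U₀)0 = 0`: every line is `0 ≤ 0·|f|`
    intro α₀ U₀ hU₀ _ _ _ A _ f _ _
    have hz := hG0 U₀ hU₀
    simp only [show (fun z κ => (opsU hd i.η i.hη).DRDs U₀ A z κ) = fun _ _ => (0 : 𝔸₀) from rfl, hz]
    refine ⟨⟨0, fun y τ => by simp⟩, ?_, ?_, ?_⟩
    · rw [zero_mul]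
      exact B8ScaledSupNorm.msup_le le_rfl fun j hj b _ => by rw [norm_zero, mul_zero]
    · rw [zero_mul]
      exact B8ScaledSupNorm.msup_le le_rfl fun j hj t _ => by rw [covDerivFwd_zero_fun, norm_zero, mul_zero]
    · rw [zero_mul]
      refine B8ScaledSupNorm.msup_le le_rfl fun j hj b _ => ?_
      have hU1 : ∀ y κ, U₀ y κ ∈ U1 𝔸₀ := fun y κ => unitaryUnits_le_U1 (hU₀ y κ)
      have h0 : ‖covLap i.η U₀ (fun _ => (0 : 𝔸₀)) b.1‖ ≤ 0 := by
        have := B9SupplySockB9P3ZdLettersOmega.norm_covLap_le hη hU1 (f := fun _ => (0 : 𝔸₀)) (s := 0) (fun _ => by simp) b.1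
        simpa using this
      rw [le_antisymm h0 (norm_nonneg _), mul_zero]
  · -- the Hölder line of the source term: quotients of the zero field vanish
    intro α₀ U₀ hU₀ _ _ _ A _ f _ _
    have hz := hG0 U₀ hU₀
    simp only [show (fun z κ => (opsU hd i.η i.hη).DRDs U₀ A z κ) = fun _ _ => (0 : 𝔸₀) from rfl, hz]
    have hq0 : ∀ q : Fin d × Fin d × (Site d × Site d),
        hquot i.η β len U₀ (covDerivFwd i.η U₀ q.1 fun _ => (0 : 𝔸₀)) q.2.2 = 0 := by
      intro q
      have : (covDerivFwd i.η U₀ q.1 fun _ => (0 : 𝔸₀)) = fun _ => 0 := funext fun y => covDerivFwd_zero_fun i.η U₀ q.1 y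
      rw [this, hquot_zero_fun]
    refine ⟨⟨0, fun j hj q _ => by simp only [hq0, norm_zero, mul_zero, le_refl]⟩, ?_⟩
    rw [zero_mul]
    exact B8ScaledSupNorm.msup_le le_rfl fun j hj q _ => by simp only [hq0, norm_zero, mul_zero, le_refl]
  · -- Theorem 3.3's two blocks for G(U₀): local entries as designed, the γ = −3 globals by `globU_bounds`
    intro α₀ U₀ hU₀ _ _ _
    have hpref4 : ∀ (n : Fin 4) (t : ℝ), 0 ≤ t → 0 ≤ B9.pref4 t n := fun n t ht => by
      fin_cases n <;> simp [B9.pref4] <;> positivity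
    obtain ⟨gsup, gl2, ghol, gdist, gcutH, gcutSup, gw⟩ := geoU_readings (𝔸₀ := 𝔸₀) i
    obtain ⟨Ge, Gh1, Ge4, Gh2, Gl2, Gglob⟩ := GAU_readings (𝔸₀ := 𝔸₀) i hd
    refine ⟨⟨fun n lam y y' _ => ?_, fun n lam h y y' _ _ => ?_, fun n lam γ _ _ => ?_⟩, ⟨?_, ?_, ?_⟩⟩
    · rw [Ge, geoU_len, gdist, gsup, mul_zero, neg_zero, Real.exp_zero, mul_one, mul_one, one_mul]
      exact hpref4 n i.η hη.le
    · rw [Gl2, gcutSup, mul_zero, zero_mul, zero_mul]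
    · by_cases hγ : γ = -3
      · rw [Gglob, gw, if_pos hγ, if_pos hγ, one_mul]; exact globU_bounds i hd hΩ hU₀ lam n
      · rw [Gglob, gw, if_neg hγ, if_neg hγ, mul_zero]
    · intro β' lam ζ y y' _ _ _ _
      rw [Gh1, geoU_len, gcutH, gdist, gsup, mul_zero, neg_zero, Real.exp_zero, mul_one, mul_one, mul_one, one_mul]
    · intro ε lam y y' _ _ _
      rw [Ge4, gdist, ghol, gsup, mul_zero, neg_zero, Real.exp_zero, zero_add, mul_one, mul_one]
      exact zero_le_one
    · intro ε β' lam ζ y y' _ _ _ _ _ _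
      rw [Gh2, geoU_len, gcutH, gdist, ghol, gsup, mul_zero, neg_zero, Real.exp_zero, zero_add, mul_one, mul_one, mul_one, one_mul]
      exact Real.rpow_nonneg hη.le _



end Main

end Literature.MathematicalPhysics.QuantumFieldTheory.Balaban1983to89.B9SupplySockB9P3ZdGammaUnivDelta2

end
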